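import Summits.BirchSwinnertonDyer.Rank1Residual.X11b.KummerLocalIndex
import Literature.NumberTheory.EllipticCurves.CasselsTateLemma615
import Literature.NumberTheory.EllipticCurves.SelmerTorsionInclusion
import Literature.NumberTheory.GaloisRepresentations.TateDualityCounting
import HarnessLib

/-!
# X11b, routes p2/R1 — DECOMPOSING `Sel^{(n)}(E/K)` ALONG THE KUMMER SEQUENCE at a deep level:
# `Sel^{(N)} = κ_N(E(K)) + ι(Sel^{(d)})` when `Ш[N] = Ш[d]`, exponents, and the LOCAL KUMMER
# COORDINATES of Selmer classes (cell `b2b-bsdres`, sub-cell `multr1-p2`, gen 19)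

HONEST FRAMING (cell `b2b-bsdres`, run/shared/lean/b2b/bsd-rank1-residual/, verbatim in every
file): the goal of the cell is to DELETE the COMBINATION-SHAPED residual classes of the
Birch–Swinnerton-Dyer formula for ALL analytic-rank `≤ 1` elliptic curves over `ℚ` — "full BSD
formula for every rank `≤ 1` curve in class `C`" assembled STRICTLY from published theorems — so
that the rank-`≤ 1` remainder becomes exactly the CONSTRUCTION-SHAPED classes, which are TYPED
(missing-input `Prop`s), NOT attempted. This is not "finishing BSD". Sub-cell
`b2b-bsdres-multr1-p2` (X11b, route p2); a RESEARCH ROUTE; no claim beyond the stated class; X11b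
stays CONSTRUCTION-SHAPED; nothing here changes a label; no named fact is minted (theorems only; no
`sorry`).

## What is here (step 2 towards the EXACT base Selmer count, JSW17 Prop. 3.2.1 `=`)

The finite-level shadow of "`Sel_{p^∞}(E/K) = E(K) ⊗ ℚ_p/ℤ_p ⊕ (finite)`" that an EXACT count of
Castella's Selmer group needs: at a level `N` with `Ш(E/K)[N] = Ш(E/K)[d]` (`d ∣ N`; e.g. `d = p^j`
killing `Ш[p^∞]`, `N = p^k`, `k ≥ j`), every `N`-Selmer class is a Kummer class PLUS a class coming
from level `d` — and classes from level `d` have SMALL local Kummer coordinates.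

* §1 `selmerGroup_le_range_kummerMapTorsion_sup_map` — **`Sel^{(N)}(E/K) ≤ κ_N(E(K)) +
  ι_*(Sel^{(d)}(E/K))`** when `Ш ∩ H¹(K,E)[N] ⊆ H¹(K,E)[d]` (Kummer sequence at both levels:
  tree `map_torsionH1ToH1_selmerGroup_holds`, `exists_mem_selmerGroup_kummerSelmerStructure_of_mem_sha`,
  `mem_range_kummerMapTorsion_of_torsionH1ToH1_eq_zero`, `torsionH1ToH1_torsionH1OfDvd`).
* §2 `map_torsionInclusion_localKummerMap` — `ι_* κ_{d,E}(P) = κ_{N,E}(m • P)` for `N = m d` at any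
  `K`-field `E`; `res_mem_map_localKummerMap_of_mem_selmerGroup` — hence **for
  `s ∈ Sel^{(N)}`: `loc_v s ∈ κ_{N,v}(im E(K) + m • E(K_v))`** — the Tate–Shafarevich part
  contributes only `m`-MULTIPLES to the local Kummer coordinate (no torsion component).
* §3 exponents: `nsmul_mem_range_kummerMapTorsion_of_mem_selmerGroup` (`a • Sel^{(N)} ⊆ κ_N(E(K))`
  if `a` kills `Ш ∩ H¹[N]`); `exists_nsmul_sub_kummerMapTorsion_eq_zero` (if `p^c • X ⊆ κ_N(E(K))`
  for a subgroup `X ≤ H¹(K, E[p^k])` and `E(K)` has no `p`-torsion, every `x ∈ X` is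
  `κ_N(P) + f` with `p^c f = 0`); `mem_map_localKummerMap_of_nsmul_eq_zero` (a local Kummer class
  killed by `p^c` is the class of a point of `E(K_v)_tors + p^{k−c} E(K_v)`); hence
  **`res_mem_map_of_nsmul_le_range`**: `res_v(X) ⊆ κ_{N,v}(im E(K) + E(K_v)_tors + p^{k−c}E(K_v))`
  for every such `X` whose classes are Kummer at `v`.

Consumers (gen 19): the exact relaxation index at `𝔭̄` (§1–§2) and the image of the relaxed group
`kummerOutside W (p^k) {𝔭̄}` at the strict place `𝔭` modulo torsion (§3).

References: [JetchevSkinnerWan2017] Prop. 3.2.1 (arXiv:1512.06894 pp. 10–11); [SilvermanAEC2009]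
VIII.§2, Thm. X.4.2; [MilneADT2006] I §6, proof of Prop. 6.9 (the two-level Kummer diagram);
[GreenbergLNM1716] §5, proof of Prop. 5.8.
-/

noncomputable section

open scoped Classical

open CategoryTheory NumberField IsDedekindDomain Field WeierstrassCurve
open Literature.NumberTheory.EllipticCurves
open Literature.NumberTheory.GaloisRepresentations
open scoped ContRepresentation

universe u

namespace Summit.BirchSwinnertonDyer.Rank1Residual.X11b.KummerDecomp

/-! ## §0. Bridging lemmas: the localisation `res` on sums in `H¹(K, E[n])` (`galH1Torsion`) -/

section Bridge

variable {K : Type u} [Field K] (W : WeierstrassCurve K) (N : ℤ) (E : Type u) [Field E] [Algebra K E]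

/-- `res_E (x + y) = res_E x + res_E y` for `x, y : galH1Torsion W N` (the tree's two names
`galH1Torsion W N` / `galoisCohomology (W.torsionGaloisModule N) 1` for `H¹(K, E[N])` are
definitionally equal; this restates `map_add` across them). [folklore] -/
theorem res_add (x y : galH1Torsion W N) :
    galoisCohomology.res (W.torsionGaloisModule N) E 1 (x + y) =
      galoisCohomology.res (W.torsionGaloisModule N) E 1 x +
        galoisCohomology.res (W.torsionGaloisModule N) E 1 y :=
  map_add (galoisCohomology.res (W.torsionGaloisModule N) E 1) x y

/-- `res_E (x - y) = res_E x - res_E y` for `x, y : galH1Torsion W N`. [folklore] -/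
theorem res_sub (x y : galH1Torsion W N) :
    galoisCohomology.res (W.torsionGaloisModule N) E 1 (x - y) =
      galoisCohomology.res (W.torsionGaloisModule N) E 1 x -
        galoisCohomology.res (W.torsionGaloisModule N) E 1 y :=
  map_sub (galoisCohomology.res (W.torsionGaloisModule N) E 1) x y

/-- `res_E (m • x) = m • res_E x` for `x : galH1Torsion W N`. [folklore] -/
theorem res_nsmul (m : ℕ) (x : galH1Torsion W N) :
    galoisCohomology.res (W.torsionGaloisModule N) E 1 (m • x) =
      m • galoisCohomology.res (W.torsionGaloisModule N) E 1 x :=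
  map_nsmul (galoisCohomology.res (W.torsionGaloisModule N) E 1) m x

/-- `res_E (ι_* y) = (ι|_E)_* (res_E y)` for the change of level `torsionH1OfDvd` (the tree's
`galoisCohomology.res_map_one`, across the two names). [folklore] -/
theorem res_torsionH1OfDvd {d : ℤ} (h : d ∣ N) (y : galH1Torsion W d) :
    galoisCohomology.res (W.torsionGaloisModule N) E 1 (torsionH1OfDvd W h y) =
      galoisCohomology.map ((W.torsionInclusion h).restrictField E) 1
        (galoisCohomology.res (W.torsionGaloisModule d) E 1 y) :=
  galoisCohomology.res_map_one E (W.torsionInclusion h) y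

end Bridge

/-! ## §1. `Sel^{(N)} ≤ κ_N(E(K)) + ι_*(Sel^{(d)})` when `Ш[N] = Ш[d]` -/

section TwoLevels

variable {K : Type u} [Field K] [NumberField K] (W : WeierstrassCurve K) [W.IsElliptic]
  {d N : ℤ} (h : d ∣ N) (hd : d ≠ 0) (hN : N ≠ 0)

include hd in
/-- **The two-level Kummer decomposition of the Selmer group.** If every class of
`Ш(E/K) ∩ H¹(K, E)[N]` is already killed by `d` (`d ∣ N`; e.g. `d = p^j ≥` the exponent of
`Ш(E/K)[p^∞]`, `N = p^k`), then every `N`-Selmer class is a Kummer class plus the image of a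
`d`-Selmer class: `Sel^{(N)}(E/K) ≤ κ_N(E(K)) + ι_*(Sel^{(d)}(E/K))`.  Proof: the image `σ ∈ Ш[N] = Ш[d]`
of `x` lifts to `y ∈ Sel^{(d)}` (X.4.2(a) at level `d`), and `x − ι_* y` dies in `H¹(K, E)`, so it is a
Kummer class (exactness of the Kummer sequence at `H¹(K, E[N])`).
[cite: SilvermanAEC2009, Thm X.4.2(a) and §VIII.2] [cite: MilneADT2006, Ch. I §6, proof of Prop. 6.9] -/
theorem selmerGroup_le_range_kummerMapTorsion_sup_map
    (hSha : W.sha ⊓ AddSubgroup.torsionBy W.galH1 N ≤ AddSubgroup.torsionBy W.galH1 d) :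
    selmerGroup W N ≤
      (kummerMapTorsion W N (W.zsmul_geomPoints_surjective_holds hN)).range ⊔
        (selmerGroup W d).map (torsionH1OfDvd W h) := by
  haveI : PerfectField K := PerfectField.ofCharZero
  intro x hx
  -- the image of `x` in `Ш ∩ H¹(K,E)[N] ⊆ H¹(K,E)[d]`
  have hσ : torsionH1ToH1 W N x ∈ W.sha ⊓ AddSubgroup.torsionBy W.galH1 N := by
    rw [← map_torsionH1ToH1_selmerGroup_holds W hN]
    exact ⟨x, hx, rfl⟩
  have hσd : d • torsionH1ToH1 W N x = 0 := hSha hσ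
  -- lift it at level `d`
  obtain ⟨y, hy, hyσ⟩ :=
    W.exists_mem_selmerGroup_kummerSelmerStructure_of_mem_sha d hd hσ.1 hσd
  rw [← selmerGroup_eq_selmerGroup_kummerSelmerStructure] at hy
  -- `x - ι y` dies in `H¹(K, E)`: a Kummer class
  have h0 : torsionH1ToH1 W N (x - torsionH1OfDvd W h y) = 0 := by
    rw [map_sub, torsionH1ToH1_torsionH1OfDvd, hyσ, sub_self]
  have hκ := mem_range_kummerMapTorsion_of_torsionH1ToH1_eq_zero W N
    (W.zsmul_geomPoints_surjective_holds hN) _ h0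
  have hxeq : x = (x - torsionH1OfDvd W h y) + torsionH1OfDvd W h y := (sub_add_cancel x _).symm
  rw [hxeq]
  exact AddSubgroup.add_mem_sup hκ ⟨y, hy, rfl⟩

end TwoLevels

/-! ## §2. Local Kummer coordinates of classes coming from level `d` -/

section LocalTwoLevels

variable {K : Type u} [Field K] [CharZero K] (W : WeierstrassCurve K) [W.IsElliptic]
  (E : Type u) [Field E] [Algebra K E] {d N : ℤ} (h : d ∣ N) (hd : d ≠ 0) (hN : N ≠ 0)

/-- **`ι_* κ_{d,E}(P) = κ_{N,E}(m • P)`** for `N = m d` and `P ∈ (W⁄E)(E)`: the level-`d` local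
Kummer class of `P` pushed to level `N` is the level-`N` Kummer class of `m P` (same root `Q`,
`dQ = P`, `NQ = mP`; tree `map_torsionInclusion_localKummerClass`).
[cite: MilneADT2006, Ch. I §6, proof of Prop. 6.9] [cite: SilvermanAEC2009, §VIII.2] -/
theorem map_torsionInclusion_localKummerMap {m : ℤ} (hm : N = m * d)
    (P : (W.baseChange E).toAffine.Point) :
    galoisCohomology.map ((W.torsionInclusion h).restrictField E) 1 (W.localKummerMap E hd P) =
      W.localKummerMap E hN (m • P) := by
  set Q := W.localZSMulRoot E hd P with hQ
  have hdQ : d • Q = W.baseChangeGeomPointsEquiv E (toGeomPoints (W.baseChange E) P) :=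
    W.zsmul_localZSMulRoot E hd P
  have hNQ : N • Q = W.baseChangeGeomPointsEquiv E (toGeomPoints (W.baseChange E) (m • P)) := by
    rw [hm, mul_smul, hdQ, ← map_zsmul, ← map_zsmul]
  have hfixN : N • Q ∈ MulAction.fixedPoints (absoluteGaloisGroup E) (localPoints W E) :=
    W.zsmul_mem_fixedPoints_of_eq E hNQ
  change galoisCohomology.map ((W.torsionInclusion h).restrictField E) 1
    (W.localKummerClass d hd Q (W.zsmul_mem_fixedPoints_of_eq E hdQ)) = _
  rw [W.map_torsionInclusion_localKummerClass h hd hN Q _ hfixN]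
  exact (W.localKummerMap_eq_localKummerClass E hN (m • P) Q hfixN hNQ).symm

end LocalTwoLevels

section LocalImage

variable {K : Type u} [Field K] [NumberField K] (W : WeierstrassCurve K) [W.IsElliptic]
  {d N : ℤ} (h : d ∣ N) (hd : d ≠ 0) (hN : N ≠ 0)

include h hd in
/-- **Local Kummer coordinates of Selmer classes at a deep level.** Under the hypothesis of §1
(`Ш ∩ H¹[N] ⊆ H¹[d]`, `N = m d`), at every place `v` and for every `s ∈ Sel^{(N)}(E/K)`:
`loc_v s ∈ κ_{N,v}(im E(K) + m • E(K_v))` — the localisation of `s` is the level-`N` Kummer class of a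
point of `im (E(K) → E(K_v)) + m E(K_v)`.  (The Tate–Shafarevich part of `s` comes from level `d`,
whose local Kummer classes are those of `m`-multiples at level `N`.)
[cite: JetchevSkinnerWan2017, Prop. 3.2.1 (arXiv:1512.06894 pp. 10–11)]
[cite: MilneADT2006, Ch. I §6, proof of Prop. 6.9] [cite: SilvermanAEC2009, X.§4 diagram (**)] -/
theorem res_mem_map_localKummerMap_of_mem_selmerGroup {m : ℤ} (hm : N = m * d)
    (hSha : W.sha ⊓ AddSubgroup.torsionBy W.galH1 N ≤ AddSubgroup.torsionBy W.galH1 d)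
    (v : Place K) {s : galH1Torsion W N} (hs : s ∈ selmerGroup W N) :
    galoisCohomology.res (W.torsionGaloisModule N) (Place.Completion v) 1 s ∈
      ((Affine.Point.baseChange (W' := W) K (Place.Completion v)).range ⊔
        (zsmulAddGroupHom m : (W.baseChange (Place.Completion v)).toAffine.Point →+ _).range).map
        (W.localKummerMap (Place.Completion v) hN) := by
  haveI : CharZero (Place.Completion v) := charZero_placeCompletion (K := K) v
  set F := Place.Completion v with hF
  obtain ⟨a, ⟨P, rfl⟩, b, ⟨y, hy, rfl⟩, rfl⟩ := AddSubgroup.mem_sup.mp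
    (selmerGroup_le_range_kummerMapTorsion_sup_map W h hd hN hSha hs)
  -- the local Kummer class of `y` at `v` is `κ_{d,v}(R)`
  have hyv : galoisCohomology.res (W.torsionGaloisModule d) F 1 y ∈ W.kummerLocalConditionAt d F :=
    (W.mem_selmerGroup_iff_forall_localization_mem d y).mp hy v
  rw [← W.range_localKummerMap F hd] at hyv
  obtain ⟨R, hR⟩ := hyv
  -- compute the localisation
  rw [res_add, KummerIndex.res_kummerMapTorsion_eq_localKummerMap W F hN, res_torsionH1OfDvd, ← hR,
    map_torsionInclusion_localKummerMap W F h hd hN hm R, ← map_add]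
  exact ⟨_, AddSubgroup.add_mem_sup ⟨P, rfl⟩ ⟨R, rfl⟩, rfl⟩

end LocalImage

/-! ## §3. Exponents: `a • Sel^{(N)} ⊆ κ_N(E(K))`, and classes congruent to Kummer classes modulo
`p^c`-torsion -/

section Exponents

variable {K : Type u} [Field K] [NumberField K] (W : WeierstrassCurve K) [W.IsElliptic]
  {N : ℤ} (hN : N ≠ 0)

/-- **`a • Sel^{(N)}(E/K) ⊆ κ_N(E(K))` whenever `a` kills `Ш(E/K) ∩ H¹(K, E)[N]`** (e.g. `a = p^j` the
exponent of `Ш[p^∞]`, `N = p^k`): `a s` dies in `H¹(K, E)`, hence is a Kummer class.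
[cite: SilvermanAEC2009, Thm X.4.2(a) and §VIII.2] -/
theorem nsmul_mem_range_kummerMapTorsion_of_mem_selmerGroup (a : ℕ)
    (hSha : ∀ z ∈ W.sha ⊓ AddSubgroup.torsionBy W.galH1 N, a • z = 0)
    {s : galH1Torsion W N} (hs : s ∈ selmerGroup W N) :
    a • s ∈ (kummerMapTorsion W N (W.zsmul_geomPoints_surjective_holds hN)).range := by
  haveI : PerfectField K := PerfectField.ofCharZero
  have hσ : torsionH1ToH1 W N s ∈ W.sha ⊓ AddSubgroup.torsionBy W.galH1 N := by
    rw [← map_torsionH1ToH1_selmerGroup_holds W hN]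
    exact ⟨s, hs, rfl⟩
  exact mem_range_kummerMapTorsion_of_torsionH1ToH1_eq_zero W N _ _
    (by rw [map_nsmul, hSha _ hσ])

variable (p k : ℕ) [Fact p.Prime]

omit [NumberField K] [W.IsElliptic] [Fact p.Prime] in
/-- No `p`-torsion ⟹ no `p^c`-torsion. [folklore] -/
theorem eq_zero_of_pow_nsmul_eq_zero {A : Type*} [AddCommGroup A]
    (hA : ∀ x : A, p • x = 0 → x = 0) (c : ℕ) {x : A} (hx : p ^ c • x = 0) : x = 0 := by
  induction c generalizing x with
  | zero => simpa using hx
  | succ c ih =>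
    rw [pow_succ, mul_smul] at hx
    exact hA x (ih hx)

omit [Fact p.Prime] in
/-- **Divisibility inside the Kummer image.** At level `N = p^k`, if `E(K)` has no `p`-torsion, a
Kummer class `z = κ_N(P)` killed by `p^b` (`b ≤ k`) is `p^{k−b} • κ_N(P')`: indeed `p^b P ∈ ker κ_N =
p^k E(K)` forces `P ∈ p^{k−b} E(K)`. [cite: SilvermanAEC2009, §VIII.2 (exactness at E(K)/mE(K))] -/
theorem exists_eq_pow_nsmul_kummerMapTorsion (hNk : N = ((p ^ k : ℕ) : ℤ))
    (hE : ∀ P : W.toAffine.Point, p • P = 0 → P = 0) {z : galH1Torsion W N}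
    (hz : z ∈ (kummerMapTorsion W N (W.zsmul_geomPoints_surjective_holds hN)).range)
    {b : ℕ} (hb : b ≤ k) (hbz : p ^ b • z = 0) :
    ∃ P : W.toAffine.Point,
      z = p ^ (k - b) • kummerMapTorsion W N (W.zsmul_geomPoints_surjective_holds hN) P := by
  haveI : PerfectField K := PerfectField.ofCharZero
  obtain ⟨P₀, rfl⟩ := hz
  have hker : p ^ b • P₀ ∈ (kummerMapTorsion W N (W.zsmul_geomPoints_surjective_holds hN)).ker := by
    rw [AddMonoidHom.mem_ker, map_nsmul, hbz]
  rw [kummerMapTorsion_ker] at hker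
  obtain ⟨P', hP'⟩ := hker
  rw [zsmulAddGroupHom_apply, hNk, natCast_zsmul] at hP'
  -- `p^b • (P₀ - p^{k-b} • P') = 0`
  have h0 : p ^ b • (P₀ - p ^ (k - b) • P') = 0 := by
    rw [smul_sub, smul_smul, pow_mul_pow_sub p hb, hP', sub_self]
  have hP₀ : P₀ = p ^ (k - b) • P' := sub_eq_zero.mp (eq_zero_of_pow_nsmul_eq_zero p hE b h0)
  exact ⟨P', by rw [hP₀, map_nsmul]⟩

omit [NumberField K] [W.IsElliptic] [Fact p.Prime] in
/-- Every class of `H¹(K, E[p^k])` is killed by `p^k`. [folklore] -/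
theorem pow_nsmul_galH1Torsion_eq_zero (hNk : N = ((p ^ k : ℕ) : ℤ)) (x : galH1Torsion W N) :
    p ^ k • x = 0 := by
  subst hNk
  exact nsmul_continuousCohomology_one_eq_zero _ (p ^ k)
    (fun T : W.geomTorsion ((p ^ k : ℕ) : ℤ) ↦ AddSubgroup.torsionBy.nsmul T) x

omit [Fact p.Prime] in
/-- **Classes congruent to Kummer classes modulo `p^c`-torsion.** At level `N = p^k`, `E(K)` without
`p`-torsion: if `p^c • X ⊆ κ_N(E(K))` for a subgroup `X ≤ H¹(K, E[p^k])` (`c ≤ k`), then every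
`x ∈ X` is `κ_N(P) + f` with `p^c • f = 0` — the finite-level form of "`X = (E(K) ⊗ ℚ_p/ℤ_p)[p^k] ⊕
(finite of exponent p^c)`" for the `E[p^∞]`-Selmer group `X` propagates from.
[cite: GreenbergLNM1716, §5 proof of Prop. 5.8] [cite: JetchevSkinnerWan2017, Prop. 3.2.1 (proof)] -/
theorem exists_nsmul_sub_kummerMapTorsion_eq_zero (hNk : N = ((p ^ k : ℕ) : ℤ))
    (hE : ∀ P : W.toAffine.Point, p • P = 0 → P = 0) (X : AddSubgroup (galH1Torsion W N))
    {c : ℕ} (hc : c ≤ k)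
    (hX : ∀ x ∈ X, p ^ c • x ∈ (kummerMapTorsion W N (W.zsmul_geomPoints_surjective_holds hN)).range)
    {x : galH1Torsion W N} (hx : x ∈ X) :
    ∃ P : W.toAffine.Point,
      p ^ c • (x - kummerMapTorsion W N (W.zsmul_geomPoints_surjective_holds hN) P) = 0 := by
  have hz : p ^ (k - c) • (p ^ c • x) = 0 := by
    rw [smul_smul, ← pow_add, Nat.sub_add_cancel hc]
    exact pow_nsmul_galH1Torsion_eq_zero W p k hNk x
  obtain ⟨P, hP⟩ := exists_eq_pow_nsmul_kummerMapTorsion W hN p k hNk hE (hX x hx)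
    (Nat.sub_le k c) hz
  rw [Nat.sub_sub_self hc] at hP
  exact ⟨P, by rw [smul_sub, hP, sub_self]⟩

/-- **A local Kummer class killed by `p^c` is the class of a point of `E(K_v)_tors + p^{k−c} E(K_v)`**
(at level `N = p^k`, any `K`-field of characteristic `0`): if `p^c κ_N(Q) = 0` then `p^c Q = p^k R`,
so `Q − p^{k−c} R` is torsion. [cite: SilvermanAEC2009, §VIII.2 (exactness at E(K)/mE(K))] -/
theorem mem_map_localKummerMap_of_nsmul_eq_zero (hNk : N = ((p ^ k : ℕ) : ℤ))
    (E : Type u) [Field E] [Algebra K E] [CharZero E]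
    {f : galoisCohomology (GaloisRep.restrictField E (W.torsionGaloisModule N)) 1}
    (hf : f ∈ W.kummerLocalConditionAt N E) {c : ℕ} (hc : c ≤ k) (hcf : p ^ c • f = 0) :
    f ∈ (AddCommGroup.torsion (W.baseChange E).toAffine.Point ⊔
        (zsmulAddGroupHom ((p ^ (k - c) : ℕ) : ℤ) : (W.baseChange E).toAffine.Point →+ _).range).map
      (W.localKummerMap E hN) := by
  rw [← W.range_localKummerMap E hN] at hf
  obtain ⟨Q, rfl⟩ := hf
  have hker : p ^ c • Q ∈ (W.localKummerMap E hN).ker := by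
    rw [AddMonoidHom.mem_ker, map_nsmul, hcf]
  rw [W.ker_localKummerMap E hN] at hker
  obtain ⟨R, hR⟩ := hker
  rw [zsmulAddGroupHom_apply, hNk, natCast_zsmul] at hR
  have h0 : p ^ c • (Q - p ^ (k - c) • R) = 0 := by
    rw [smul_sub, smul_smul, pow_mul_pow_sub p hc, hR, sub_self]
  have htors : Q - p ^ (k - c) • R ∈ AddCommGroup.torsion (W.baseChange E).toAffine.Point :=
    (AddCommGroup.mem_torsion _).mpr (isOfFinAddOrder_iff_nsmul_eq_zero.mpr
      ⟨p ^ c, pow_pos (Fact.out : p.Prime).pos c, h0⟩)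
  refine ⟨Q, ?_, rfl⟩
  have hQ : Q = (Q - p ^ (k - c) • R) + p ^ (k - c) • R := (sub_add_cancel Q _).symm
  rw [hQ]
  exact AddSubgroup.add_mem_sup htors ⟨R, by rw [zsmulAddGroupHom_apply, natCast_zsmul]⟩

/-- **The local Kummer coordinates of a subgroup `X ≤ H¹(K, E[p^k])` with `p^c • X ⊆ κ_N(E(K))`,
at a `K`-field `E` (a completion) where its classes are Kummer**:
`res_E(X) ⊆ κ_{N,E}(im E(K) + (W⁄E)(E)_tors + p^{k−c} (W⁄E)(E))`.
Used for `X = kummerOutside W (p^k) {𝔭̄}` (Kummer at every `v ≠ 𝔭̄`) at the strict place `v = 𝔭`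
of Castella's Selmer group, where the condition is read modulo torsion anyway.
[cite: JetchevSkinnerWan2017, Prop. 3.2.1 and §3.3.1 (arXiv:1512.06894 pp. 10–11)]
[cite: GreenbergLNM1716, §5 proof of Prop. 5.8] -/
theorem res_mem_map_of_nsmul_le_range (hNk : N = ((p ^ k : ℕ) : ℤ))
    (hE : ∀ P : W.toAffine.Point, p • P = 0 → P = 0) (X : AddSubgroup (galH1Torsion W N))
    {c : ℕ} (hc : c ≤ k)
    (hX : ∀ x ∈ X, p ^ c • x ∈ (kummerMapTorsion W N (W.zsmul_geomPoints_surjective_holds hN)).range)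
    (E : Type u) [Field E] [Algebra K E] [CharZero E]
    (hXE : ∀ x ∈ X, galoisCohomology.res (W.torsionGaloisModule N) E 1 x ∈ W.kummerLocalConditionAt N E)
    {x : galH1Torsion W N} (hx : x ∈ X) :
    galoisCohomology.res (W.torsionGaloisModule N) E 1 x ∈
      ((Affine.Point.baseChange (W' := W) K E).range ⊔
        (AddCommGroup.torsion (W.baseChange E).toAffine.Point ⊔
          (zsmulAddGroupHom ((p ^ (k - c) : ℕ) : ℤ) : (W.baseChange E).toAffine.Point →+ _).range)).map
        (W.localKummerMap E hN) := by
  obtain ⟨P, hP⟩ := exists_nsmul_sub_kummerMapTorsion_eq_zero W hN p k hNk hE X hc hX hx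
  set f : galH1Torsion W N :=
    x - kummerMapTorsion W N (W.zsmul_geomPoints_surjective_holds hN) P with hfdef
  have hκP : galoisCohomology.res (W.torsionGaloisModule N) E 1
      (kummerMapTorsion W N (W.zsmul_geomPoints_surjective_holds hN) P) =
      W.localKummerMap E hN (Affine.Point.baseChange (W' := W) K E P) :=
    KummerIndex.res_kummerMapTorsion_eq_localKummerMap W E hN _ P
  -- `res_E f` is Kummer and killed by `p^c`
  have hfE : galoisCohomology.res (W.torsionGaloisModule N) E 1 f ∈ W.kummerLocalConditionAt N E := by
    rw [hfdef, res_sub, hκP]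
    exact AddSubgroup.sub_mem _ (hXE x hx) (W.localKummerMap_mem E hN _)
  have hcf : p ^ c • galoisCohomology.res (W.torsionGaloisModule N) E 1 f = 0 := by
    rw [← res_nsmul, hP]
    exact map_zero _
  obtain ⟨Q, hQ, hQf⟩ := mem_map_localKummerMap_of_nsmul_eq_zero W hN p k hNk E hfE hc hcf
  -- `res_E x = κ_{N,E}(P_E) + res_E f`
  have hx' : x = kummerMapTorsion W N (W.zsmul_geomPoints_surjective_holds hN) P + f := by
    rw [hfdef, add_sub_cancel]
  rw [hx', res_add, hκP, ← hQf, ← map_add]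
  exact ⟨_, AddSubgroup.add_mem_sup ⟨P, rfl⟩ hQ, rfl⟩

end Exponents

end Summit.BirchSwinnertonDyer.Rank1Residual.X11b.KummerDecomp

end
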